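import Mathlib
import HarnessLib
import Summits.HubbardSuperconductivity.HubbardSuperconductivity.Theorems.KLProgrammeKLRegimeSplitTwoLegCounterVertex
import Summits.HubbardSuperconductivity.HubbardSuperconductivity.Theorems.KLProgrammeKLRegimeEngineV8TowerExports2

/-!
# Route `KLProgramme` — crux K3 ENGINE (stmt-HubbardSuperconductivity-20437 `KLRegimeEngineV17F2`), stub (C) (C2) branch + (X) exports,
# located risk #17 «(C2)-MOMENTS» (R85a)(B): THE ORDER-`j` TWO-LEG SPACE-MOMENT EXPORT TWIN — atom, export, bridge rows, producer step,
# deferred package and unroll closer (plan g22 (R136): substitute typer = seat hubbard-kl-k3c2-p3 g11; consumer interface = p1b g14's §PM5H)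

The (C2) door `transport_jets_flow` (…FlowReadTransport) reads NESTED sizes `‖Dʲ F‖ ≤ M_j`, `1 ≤ j ≤ 5`, of the cumulative symbol
`F = evalM K_n + evalM (symInterp L S̃_n)` split into the frame (sized in momentum space) and the `K_n`-SEPARATED data
`S̃_n k = klLocSelfEnergyRe … K_n n k − K_n(p_k)` (sized in position space): `KLRegimeSplit.cumulativeSymbol_nested_sizes_of_split … ha hb`
(…FlowReadTransportSplit, seat k3c3-p1 g9) wants `hb : ∀ j, 1 ≤ j → j ≤ 5 → ∀ q, ‖iteratedFDeriv ℝ j (evalM (symInterp L S̃_n)) q‖ ≤ b j` —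
DERIVATIVE ORDERS ONLY.  By `TwoLegFourier.klLocSelfEnergyRe_sub_frame_eq_locRe` (every scale) `S̃_n` IS the localised two-leg data of the
Grassmann element `G' = 𝒱⁽ⁿ⁾[K] − 𝒩_K = klEffectiveAction … K klE0 n − counterQuadratic L M β K`, and p1b's off-diagonal Fourier bridge
`TwoLegFourier.norm_iteratedFDeriv_evalM_symInterp_locRe_le_offDiag` (generic `G`, every order `k ≥ 1`) turns SPATIALLY OFF-DIAGONAL pinned
position moments of `G'`'s plain two-leg kernels into exactly those jets.  Hence the three body decisions of the text (KL STATUS 2026-08-28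
STARTED line of k3c2-p3 g11; k3c3-p1 g9's words l.4398 law A / l.4426 (†) separated kernel):

* (D1) KERNEL = SEPARATED: `klEffectiveAction L M β U μ K klE0 n − counterQuadratic L M β K`;
* (D2) DIAGONAL = OUT, ORDERS `1 … d`: the atom sums over `x 0 = x₀ ∧ (x 1).2 ≠ (x 0).2` (the `hMsh` shape of the landed scale-0 separated
  export `twoLeg_scaleZero_sep_moments_of_counterSeparated`); the spatially local part (the O(U) on-site tadpole) never enters a derivative order;
* (D3) UNITS = law A: budgets `Z j · U² · (4ⁿ)^{j−1}` — literally the right-hand side of `hlaw_j` in `transport_jets_flow_fit` with `m j := 2·Z j`.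

§1 `TwoLegSpaceMomentAt L M Z β U μ K n j` (atom), `TwoLegDualSpaceMomentsUpToAt L M Z β U μ n d` (export at the flow frame, `1 ≤ j ≤ d`),
monotonicity rows, and the bridge rows `norm_iteratedFDeriv_evalM_sep_le_of_twoLegSpaceMomentAt` / **`sep_jets_of_twoLegDualSpaceMomentsUpToAt`**
(= the literal `hb` at `K_n` with `b j = 2·Z j`).
§2 (p1b g14's pre-built §PM5H, names without `_PH`): `klZspLaw` (law A), the J1-shaped producer step `TwoLegSpaceMomentsStep5 P R Q₀ G Z u`
(`LevelsUStep2`'s binder list at `(G, Q)` for every raise `Q` of `Q₀`, doors `klEngC₃6/klEngU₀10/u Q cc/klEngL₄/klEngM₃`, `n ≤ n_β+1`,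
`HistP … G P Q …`, `FrameOK (K_n)`, `EngineBoundsAtV17F2 … n`, the export HISTORY `∀ j < n` ⇒ the export at `n`), `IsSpaceMomPkg5`, the deferred
`dite/choose` package `klSpaceMomPkg5 P R Q₀ G` with projections `klZsp5`/`klZspU5`/`klZsp5At`, `_pos`, and the UNROLL CLOSER
`twoLegDualSpaceMomentsUpToAt_all_of_exists`.
Definitions with bodies + closed rows; nothing about the model is asserted (the step is an (X)-export HYPOTHESIS of the engine thesis, to be
produced by the E1 levels package); nothing here asserts any stub, K3 or superconductivity.
References: BGM 2006 §2.3 (2.17), §3 (3.5)–(3.6) [cite: BenfattoGiulianiMastropietro2006].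
-/

noncomputable section

namespace Summit.HubbardSuperconductivity.HubbardSuperconductivity.Theorems.EngineV8

set_option linter.dupNamespace false -- summit = problem name (single-conjunct summit), D-0017

open Real Finset Literature.MathematicalPhysics.QuantumLattice Literature.Probability.LatticeModels
open Literature.MathematicalPhysics.QuantumLattice.FermiRG
open Summit.HubbardSuperconductivity.HubbardSuperconductivity.Theorems.KLRegimeSplit
open Summit.HubbardSuperconductivity.HubbardSuperconductivity.Theorems.KLProgrammeLegKernels
open Summit.HubbardSuperconductivity.HubbardSuperconductivity.Theorems.DispersionFlow
open Summit.HubbardSuperconductivity.HubbardSuperconductivity.Theorems.TwoLegFourier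

/-! ## §1 The atom, the export at the flow frame, and the bridge to the (C2) split -/

section Model

variable (L M : ℕ) [NeZero L] [NeZero M]

/-- **`TwoLegSpaceMomentAt L M Z β U μ K n j`** — the order-`j` pinned, SPATIALLY OFF-DIAGONAL space moment of the PLAIN two-leg position
kernels of the `K`-SEPARATED scale-`n` action `G' = klEffectiveAction … K klE0 n − counterQuadratic L M β K`: for both spins `σ` and every pin `x₀`,
`ε·Σ_{x : x 0 = x₀, x⃗₁ ≠ x⃗₀} (1 + |Δx̃₀| + |Δx̃₁|)ʲ·‖sectorisedKernel (trivialMultiplier) G' 2 ((0,σ,+),(0,σ,−)) x‖ ≤ Z` (`ε = imagTimeWeight β M`) —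
VERBATIM the hypothesis `hMs` of `TwoLegFourier.norm_iteratedFDeriv_evalM_symInterp_locRe_le_offDiag` at `G := G'`. -/
def TwoLegSpaceMomentAt (Z : ℝ) (β U μ : ℝ) (K : TrigPolyC4v) (n j : ℕ) : Prop :=
  ∀ (σ : Fin 2) (x₀ : SpaceTimeIdx L M), imagTimeWeight β M *
    ∑ x ∈ (univ : Finset (Fin 2 → SpaceTimeIdx L M)).filter (fun x => x 0 = x₀ ∧ (x 1).2 ≠ (x 0).2),
      (1 + ((((x 1).2 - (x 0).2) 0).valMinAbs.natAbs : ℝ) + ((((x 1).2 - (x 0).2) 1).valMinAbs.natAbs : ℝ)) ^ j *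
        ‖sectorisedKernel L M β (trivialMultiplier L M)
            (KLProgrammeLegKernels.klEffectiveAction L M β U μ K klE0 n - counterQuadratic L M β K) 2
          (![((0, σ), 0), ((0, σ), 1)] : Fin 2 → SectorLeg 1) x‖ ≤ Z

/-- **`TwoLegDualSpaceMomentsUpToAt L M Z β U μ n d`** — the export at the flow frame: for every order `1 ≤ j ≤ d`,
`TwoLegSpaceMomentAt … (Z j) … (klFlowFrameU L M β U μ n) n j` (`d = 5` is the order-`≤ 5` package of located risk #17; the (C2) door reads
derivative orders only, so there is no `j = 0` clause). -/
def TwoLegDualSpaceMomentsUpToAt (Z : ℕ → ℝ) (β U μ : ℝ) (n d : ℕ) : Prop :=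
  ∀ j, 1 ≤ j → j ≤ d → TwoLegSpaceMomentAt L M (Z j) β U μ (klFlowFrameU L M β U μ n) n j

variable {L M}

omit [NeZero M] in
/-- Budget monotonicity of the atom. -/
theorem TwoLegSpaceMomentAt.mono {Z Z' β U μ : ℝ} {K : TrigPolyC4v} {n j : ℕ} (h : TwoLegSpaceMomentAt L M Z β U μ K n j) (hZ : Z ≤ Z') :
    TwoLegSpaceMomentAt L M Z' β U μ K n j :=
  fun σ x₀ => (h σ x₀).trans hZ

omit [NeZero M] in
/-- Order monotonicity of the atom at fixed budget (the weight `(1 + |Δx̃₀| + |Δx̃₁|)ʲ` has base `≥ 1`), for `0 ≤ ε`. -/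
theorem TwoLegSpaceMomentAt.of_order_le {Z β U μ : ℝ} (hε : 0 ≤ imagTimeWeight β M) {K : TrigPolyC4v} {n j j' : ℕ}
    (h : TwoLegSpaceMomentAt L M Z β U μ K n j') (hj : j ≤ j') : TwoLegSpaceMomentAt L M Z β U μ K n j := by
  intro σ x₀
  refine le_trans (mul_le_mul_of_nonneg_left (sum_le_sum fun x _ => ?_) hε) (h σ x₀)
  refine mul_le_mul_of_nonneg_right (pow_le_pow_right₀ ?_ hj) (norm_nonneg _)
  have h0 : (0 : ℝ) ≤ ((((x 1).2 - (x 0).2) 0).valMinAbs.natAbs : ℝ) := Nat.cast_nonneg _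
  have h1 : (0 : ℝ) ≤ ((((x 1).2 - (x 0).2) 1).valMinAbs.natAbs : ℝ) := Nat.cast_nonneg _
  linarith

/-- The export at one order. -/
theorem TwoLegDualSpaceMomentsUpToAt.apply {Z : ℕ → ℝ} {β U μ : ℝ} {n d : ℕ} (h : TwoLegDualSpaceMomentsUpToAt L M Z β U μ n d) {j : ℕ}
    (hj1 : 1 ≤ j) (hjd : j ≤ d) : TwoLegSpaceMomentAt L M (Z j) β U μ (klFlowFrameU L M β U μ n) n j :=
  h j hj1 hjd

/-- Budget monotonicity of the export. -/
theorem TwoLegDualSpaceMomentsUpToAt.mono {Z Z' : ℕ → ℝ} {β U μ : ℝ} {n d : ℕ} (h : TwoLegDualSpaceMomentsUpToAt L M Z β U μ n d)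
    (hZ : ∀ j, 1 ≤ j → j ≤ d → Z j ≤ Z' j) : TwoLegDualSpaceMomentsUpToAt L M Z' β U μ n d :=
  fun j hj1 hjd => (h j hj1 hjd).mono (hZ j hj1 hjd)

/-- Lower-order packages follow from higher ones. -/
theorem TwoLegDualSpaceMomentsUpToAt.of_le {Z : ℕ → ℝ} {β U μ : ℝ} {n d d' : ℕ} (h : TwoLegDualSpaceMomentsUpToAt L M Z β U μ n d')
    (hd : d ≤ d') : TwoLegDualSpaceMomentsUpToAt L M Z β U μ n d :=
  fun j hj1 hjd => h j hj1 (hjd.trans hd)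

/-- The export from its clauses (introduction row). -/
theorem twoLegDualSpaceMomentsUpToAt_of_forall {Z : ℕ → ℝ} {β U μ : ℝ} {n d : ℕ}
    (h : ∀ j, 1 ≤ j → j ≤ d → TwoLegSpaceMomentAt L M (Z j) β U μ (klFlowFrameU L M β U μ n) n j) :
    TwoLegDualSpaceMomentsUpToAt L M Z β U μ n d :=
  h

/-- **THE BRIDGE BY NAME (one order)**: for `1 ≤ j` and `0 < β`, the atom bounds the `j`-th jet of the interpolant of the `K`-separated two-leg
data — `‖Dʲ evalM (symInterp L (klLocSelfEnergyRe … K n − K∘p)) q‖ ≤ 2·Z` at every momentum (`klLocSelfEnergyRe_sub_frame_eq_locRe` ∘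
`norm_iteratedFDeriv_evalM_symInterp_locRe_le_offDiag`). -/
theorem norm_iteratedFDeriv_evalM_sep_le_of_twoLegSpaceMomentAt {Z β U μ : ℝ} (hβ : 0 < β) {K : TrigPolyC4v} {n j : ℕ} (hj : 1 ≤ j)
    (h : TwoLegSpaceMomentAt L M Z β U μ K n j) (q : Momentum) :
    ‖iteratedFDeriv ℝ j (evalM (symInterp L (fun p => klLocSelfEnergyRe L M β U μ K n p - K.eval (latticeMomentum L p)))) q‖ ≤ 2 * Z := by
  have hfun : (fun p => klLocSelfEnergyRe L M β U μ K n p - K.eval (latticeMomentum L p)) = fun p =>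
      (∑ σ : Fin 2, ((selfEnergy L M β (KLProgrammeLegKernels.klEffectiveAction L M β U μ K klE0 n - counterQuadratic L M β K)
        (omega0 M, p) σ).re + (selfEnergy L M β (KLProgrammeLegKernels.klEffectiveAction L M β U μ K klE0 n - counterQuadratic L M β K)
        ((omega0 M).rev, p) σ).re)) / 4 :=
    funext (klLocSelfEnergyRe_sub_frame_eq_locRe hβ.ne' U μ K n)
  rw [hfun]
  exact norm_iteratedFDeriv_evalM_symInterp_locRe_le_offDiag hβ _ hj h q

/-- **THE BRIDGE BY NAME (the package) — the LITERAL `hb` of `KLRegimeSplit.cumulativeSymbol_nested_sizes_of_split` at the flow frame**: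
the export with budgets `Z` gives, for every `1 ≤ j ≤ d` and every momentum,
`‖iteratedFDeriv ℝ j (evalM (symInterp L (fun k => klLocSelfEnergyRe … K_n n k − K_n.eval (latticeMomentum L k)))) q‖ ≤ 2·Z j`
(take `d = 5`, `b j := 2·Z j`). -/
theorem sep_jets_of_twoLegDualSpaceMomentsUpToAt {Z : ℕ → ℝ} {β U μ : ℝ} (hβ : 0 < β) {n d : ℕ}
    (h : TwoLegDualSpaceMomentsUpToAt L M Z β U μ n d) :
    ∀ j, 1 ≤ j → j ≤ d → ∀ q : Momentum,
      ‖iteratedFDeriv ℝ j (evalM (symInterp L (fun k => klLocSelfEnergyRe L M β U μ (klFlowFrameU L M β U μ n) n k -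
        (klFlowFrameU L M β U μ n).eval (latticeMomentum L k)))) q‖ ≤ 2 * Z j :=
  fun _ hj1 hjd q => norm_iteratedFDeriv_evalM_sep_le_of_twoLegSpaceMomentAt hβ hj1 (h _ hj1 hjd) q

end Model

/-! ## §2 The producer step (J1 shape), the deferred package, and the unroll closer (p1b g14's §PM5H) -/

section Package

/-- **Budget law A at scale `n`**: `klZspLaw Z U n j = Z j · U² · (4ⁿ)^{j−1}` (ℕ exponent; k3c3-p1's (C2) threshold KL STATUS 2026-08-28 l.4398:
order `1` n-free = class #7's `Zs·U²`, one scale ratio `4ⁿ = klE0/Λ_n` per further order) — the right-hand side of `hlaw_j` in `transport_jets_flow_fit`. -/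
def klZspLaw (Z : ℕ → ℝ) (U : ℝ) (n : ℕ) : ℕ → ℝ := fun j => Z j * U ^ 2 * ((4 : ℝ) ^ n) ^ (j - 1)

/-- `klZspLaw` unfolded. -/
@[simp] theorem klZspLaw_apply (Z : ℕ → ℝ) (U : ℝ) (n j : ℕ) : klZspLaw Z U n j = Z j * U ^ 2 * ((4 : ℝ) ^ n) ^ (j - 1) := rfl

/-- The doubled law is the law of the doubled table (the (C2) fit takes `m j := 2·Z j`). -/
theorem two_mul_klZspLaw (Z : ℕ → ℝ) (U : ℝ) (n j : ℕ) : 2 * klZspLaw Z U n j = (2 * Z j) * U ^ 2 * ((4 : ℝ) ^ n) ^ (j - 1) := by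
  rw [klZspLaw_apply]; ring

/-- Nonnegative tables give nonnegative laws. -/
theorem klZspLaw_nonneg {Z : ℕ → ℝ} (hZ : ∀ j, 0 ≤ Z j) (U : ℝ) (n j : ℕ) : 0 ≤ klZspLaw Z U n j := by
  rw [klZspLaw_apply]
  exact mul_nonneg (mul_nonneg (hZ j) (sq_nonneg U)) (by positivity)

/-- The law is monotone in the table. -/
theorem klZspLaw_mono {Z Z' : ℕ → ℝ} (hZ : ∀ j, Z j ≤ Z' j) (U : ℝ) (n j : ℕ) : klZspLaw Z U n j ≤ klZspLaw Z' U n j := by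
  rw [klZspLaw_apply, klZspLaw_apply]
  exact mul_le_mul_of_nonneg_right (mul_le_mul_of_nonneg_right (hZ j) (sq_nonneg U)) (by positivity)

/-- **The producer step, J1 shape (cf. `LevelsUStep2`)**: for every raise `Q` of `Q₀`, under the v2 doors (`klEngC₃6`, `klEngU₀10`, `klEngL₄ P R`,
`klEngM₃`; `n ≤ nScales β + 1`) and the step's OWN threshold `U ≤ u Q cc`: the public history at `(G, P, Q, R)`, the admissibility of `K_n`, the engine's
slots at `n` and the export at every `j < n` give the order-`≤ 5` space-moment export at `K_n` with the law-A budgets `klZspLaw Z U n`.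
(An (X)-export HYPOTHESIS of the engine thesis; its producer is the E1 levels package — tree-weighted tower re-measurement, BGM 2006 §3.) -/
def TwoLegSpaceMomentsStep5 (P : SplitConsts) (R : RenConsts) (Q₀ : EngConsts) (G : GeoConsts) (Z : ℕ → ℝ) (u : EngConsts → ℝ → ℝ) : Prop :=
  ∀ Q : EngConsts, Q₀.IsRaiseOf Q →
    ∀ cc : ℝ, 0 < cc → cc ≤ klEngC₃6 P R →
      ∀ μ ∈ klWindowC, ∀ U : ℝ, 0 < U → U ≤ klEngU₀10 P R cc → U ≤ u Q cc →
        ∀ β : ℝ, klBetaMin ≤ β → β ≤ Real.exp (cc / U ^ 2) →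
          ∀ (L M : ℕ) [NeZero L] [NeZero M], klEngL₄ P R β U ≤ L → klEngM₃ β U L ≤ M →
            ∀ n : ℕ, n ≤ nScales β + 1 →
              HistP klPredsV17F2 L M G P Q R β U μ 0 n →
                FrameOK R U (nScales β) μ (klFlowFrameU L M β U μ n) →
                  EngineBoundsAtV17F2 L M G P Q β U μ n →
                    (∀ j < n, TwoLegDualSpaceMomentsUpToAt L M (klZspLaw Z U j) β U μ j 5) →
                      TwoLegDualSpaceMomentsUpToAt L M (klZspLaw Z U n) β U μ n 5

/-- **Package admissibility**: nonnegative budget table, threshold positive at every raised package. -/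
def IsSpaceMomPkg5 (e : (ℕ → ℝ) × (EngConsts → ℝ → ℝ)) : Prop := (∀ j, 0 ≤ e.1 j) ∧ ∀ Q cc, 0 < e.2 Q cc

/-- The zero table with threshold `1` is admissible (the else-default of the deferred package). -/
theorem isSpaceMomPkg5_zero : IsSpaceMomPkg5 (fun _ => 0, fun _ _ => 1) := ⟨fun _ => le_rfl, fun _ _ => one_pos⟩

variable (P : SplitConsts) (R : RenConsts) (Q₀ : EngConsts) (G : GeoConsts)

open Classical in
/-- **The deferred package** (the `dite/choose` device of the landed export modules `klExportPkg2`/`klIsoTuplePkg`/…): the chosen admissible pair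
`(Z, u)` with `TwoLegSpaceMomentsStep5 P R Q₀ G Z u` if one exists, else `(0, 1)`. -/
def klSpaceMomPkg5 : (ℕ → ℝ) × (EngConsts → ℝ → ℝ) :=
  if h : ∃ e : (ℕ → ℝ) × (EngConsts → ℝ → ℝ), IsSpaceMomPkg5 e ∧ TwoLegSpaceMomentsStep5 P R Q₀ G e.1 e.2 then Classical.choose h
  else (fun _ => 0, fun _ _ => 1)

/-- **Budget table of the deferred package** (n-free, per order). -/
def klZsp5 : ℕ → ℝ := (klSpaceMomPkg5 P R Q₀ G).1

/-- **Threshold of the deferred package** (the `klEngU₀12` min-chain entry). -/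
def klZspU5 (Q : EngConsts) (cc : ℝ) : ℝ := (klSpaceMomPkg5 P R Q₀ G).2 Q cc

/-- **Scale-`n` budgets read by the (C) binder**: `klZsp5At P R Q₀ G U n = klZspLaw (klZsp5 P R Q₀ G) U n`, i.e.
`j ↦ klZsp5 … j · U² · (4ⁿ)^{j−1}`. -/
def klZsp5At (U : ℝ) (n : ℕ) : ℕ → ℝ := klZspLaw (klZsp5 P R Q₀ G) U n

/-- `klZsp5At` unfolded (the shape of `hlaw_j`'s right-hand side). -/
theorem klZsp5At_apply (U : ℝ) (n j : ℕ) : klZsp5At P R Q₀ G U n j = klZsp5 P R Q₀ G j * U ^ 2 * ((4 : ℝ) ^ n) ^ (j - 1) := rfl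

/-- `2 · klZsp5At … j = (2·klZsp5 … j) · U² · (4ⁿ)^{j−1}` — the `b j` of the (C2) split in law-A form (`m j := 2·klZsp5 … j`). -/
theorem two_mul_klZsp5At (U : ℝ) (n j : ℕ) : 2 * klZsp5At P R Q₀ G U n j = (2 * klZsp5 P R Q₀ G j) * U ^ 2 * ((4 : ℝ) ^ n) ^ (j - 1) :=
  two_mul_klZspLaw _ U n j

/-- The deferred package is admissible (both branches). -/
theorem isSpaceMomPkg5_klSpaceMomPkg5 : IsSpaceMomPkg5 (klSpaceMomPkg5 P R Q₀ G) := by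
  classical
  unfold klSpaceMomPkg5
  split_ifs with h
  · exact (Classical.choose_spec h).1
  · exact isSpaceMomPkg5_zero

/-- `0 ≤ klZsp5 … j`. -/
theorem klZsp5_nonneg (j : ℕ) : 0 ≤ klZsp5 P R Q₀ G j := (isSpaceMomPkg5_klSpaceMomPkg5 P R Q₀ G).1 j

/-- `0 ≤ klZsp5At … U n j`. -/
theorem klZsp5At_nonneg (U : ℝ) (n j : ℕ) : 0 ≤ klZsp5At P R Q₀ G U n j := klZspLaw_nonneg (klZsp5_nonneg P R Q₀ G) U n j

/-- **`0 < klZspU5 …`** (the `_pos` argument of the `klEngU₀12` min-chain). -/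
theorem klZspU5_pos (Q : EngConsts) (cc : ℝ) : 0 < klZspU5 P R Q₀ G Q cc := (isSpaceMomPkg5_klSpaceMomPkg5 P R Q₀ G).2 Q cc

variable {P R Q₀ G}

/-- In the `∃`-branch the deferred package satisfies the step. -/
theorem twoLegSpaceMomentsStep5_klSpaceMomPkg5
    (hex : ∃ e : (ℕ → ℝ) × (EngConsts → ℝ → ℝ), IsSpaceMomPkg5 e ∧ TwoLegSpaceMomentsStep5 P R Q₀ G e.1 e.2) :
    TwoLegSpaceMomentsStep5 P R Q₀ G (klZsp5 P R Q₀ G) (klZspU5 P R Q₀ G) := by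
  have e : klSpaceMomPkg5 P R Q₀ G = Classical.choose hex := by classical unfold klSpaceMomPkg5; rw [dif_pos hex]
  have h2 := (Classical.choose_spec hex).2
  unfold klZsp5 klZspU5
  rw [e]; exact h2

/-- **THE UNROLL CLOSER**: from the (X) conjunct (`∃ e, IsSpaceMomPkg5 e ∧ TwoLegSpaceMomentsStep5 P R Q₀ G e.1 e.2`) the (C) binder
`TwoLegDualSpaceMomentsUpToAt L M (klZsp5At P R Q₀ G U n) β U μ n 5` at ANY raise / volume / scale below the package threshold, given the export
HISTORY `∀ j < n` (fed by strong induction in the (C) stub, p1b g14's `{hhistM5}` variant) — pure application of the `choose_spec` step. -/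
theorem twoLegDualSpaceMomentsUpToAt_all_of_exists {Q : EngConsts} {cc μ U β : ℝ} {L M : ℕ} [NeZero L] [NeZero M] {n : ℕ}
    (hex : ∃ e : (ℕ → ℝ) × (EngConsts → ℝ → ℝ), IsSpaceMomPkg5 e ∧ TwoLegSpaceMomentsStep5 P R Q₀ G e.1 e.2) (hQ : Q₀.IsRaiseOf Q)
    (hc : 0 < cc) (hc36 : cc ≤ klEngC₃6 P R) (hμ : μ ∈ klWindowC) (hU : 0 < U) (hU10 : U ≤ klEngU₀10 P R cc) (hUu : U ≤ klZspU5 P R Q₀ G Q cc)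
    (hβ : klBetaMin ≤ β) (hβc : β ≤ Real.exp (cc / U ^ 2)) (hL : klEngL₄ P R β U ≤ L) (hM : klEngM₃ β U L ≤ M) (hn : n ≤ nScales β + 1)
    (hhist : HistP klPredsV17F2 L M G P Q R β U μ 0 n) (hfr : FrameOK R U (nScales β) μ (klFlowFrameU L M β U μ n))
    (hE : EngineBoundsAtV17F2 L M G P Q β U μ n)
    (hhistM5 : ∀ j < n, TwoLegDualSpaceMomentsUpToAt L M (klZsp5At P R Q₀ G U j) β U μ j 5) :
    TwoLegDualSpaceMomentsUpToAt L M (klZsp5At P R Q₀ G U n) β U μ n 5 :=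
  twoLegSpaceMomentsStep5_klSpaceMomPkg5 hex Q hQ cc hc hc36 μ hμ U hU hU10 hUu β hβ hβc L M hL hM n hn hhist hfr hE hhistM5

/-- **THE (C2) JETS AT THE (C) SITE, ONE CALL**: under the unroll closer's binders and `0 < β`, the separated-symbol jets `hb` of
`cumulativeSymbol_nested_sizes_of_split` at `K_n` hold with `b j := 2 · klZsp5At P R Q₀ G U n j`. -/
theorem sep_jets_klZsp5At_of_exists {Q : EngConsts} {cc μ U β : ℝ} {L M : ℕ} [NeZero L] [NeZero M] {n : ℕ}
    (hex : ∃ e : (ℕ → ℝ) × (EngConsts → ℝ → ℝ), IsSpaceMomPkg5 e ∧ TwoLegSpaceMomentsStep5 P R Q₀ G e.1 e.2) (hQ : Q₀.IsRaiseOf Q)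
    (hc : 0 < cc) (hc36 : cc ≤ klEngC₃6 P R) (hμ : μ ∈ klWindowC) (hU : 0 < U) (hU10 : U ≤ klEngU₀10 P R cc) (hUu : U ≤ klZspU5 P R Q₀ G Q cc)
    (hβ0 : 0 < β) (hβ : klBetaMin ≤ β) (hβc : β ≤ Real.exp (cc / U ^ 2)) (hL : klEngL₄ P R β U ≤ L) (hM : klEngM₃ β U L ≤ M)
    (hn : n ≤ nScales β + 1) (hhist : HistP klPredsV17F2 L M G P Q R β U μ 0 n) (hfr : FrameOK R U (nScales β) μ (klFlowFrameU L M β U μ n))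
    (hE : EngineBoundsAtV17F2 L M G P Q β U μ n)
    (hhistM5 : ∀ j < n, TwoLegDualSpaceMomentsUpToAt L M (klZsp5At P R Q₀ G U j) β U μ j 5) :
    ∀ j, 1 ≤ j → j ≤ 5 → ∀ q : Momentum,
      ‖iteratedFDeriv ℝ j (evalM (symInterp L (fun k => klLocSelfEnergyRe L M β U μ (klFlowFrameU L M β U μ n) n k -
        (klFlowFrameU L M β U μ n).eval (latticeMomentum L k)))) q‖ ≤ 2 * klZsp5At P R Q₀ G U n j :=
  sep_jets_of_twoLegDualSpaceMomentsUpToAt hβ0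
    (twoLegDualSpaceMomentsUpToAt_all_of_exists hex hQ hc hc36 hμ hU hU10 hUu hβ hβc hL hM hn hhist hfr hE hhistM5)

end Package

end Summit.HubbardSuperconductivity.HubbardSuperconductivity.Theorems.EngineV8

end
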